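import Summits.MatrixMultiplication.MatrixMultiplication.Theses.SnSubsetDichotomy
import Literature.NumberTheory.DiophantineGeometry.PartitionTableaux
import Literature.NumberTheory.DiophantineGeometry.FirstRowPeeling
import Literature.NumberTheory.DiophantineGeometry.SymmetricGroupReps
import Literature.NumberTheory.DiophantineGeometry.SymmetricGroupRepsFinrankSpechtProofs
import Literature.NumberTheory.DiophantineGeometry.SymmetricGroupRepsSignTwist

/-!
# Stub `stub_dimGrowth`, peeling bounds (crux stmt-MatrixMultiplication-8303, flat-tail-truncation)

Crux `Summit.MatrixMultiplication.MatrixMultiplication.Theses.SnSubsetDichotomy.GlobalBranch`, line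
`flat-tail-truncation`, stub `stub_dimGrowth` (dimension growth of the Wedderburn blocks of `ℂ[𝔖ₙ]`
away from the two ends of the dominance order). This file is the combinatorial half; the estimate
and the stub theorem are in `…StubDimGrowth.lean`.

For `μ ⊢ n` peel the first row: `μ = (a, ν)`, `ν ⊢ m = n - a` (`exists_sortedParts_eq_sup_cons`),
and let `b = ν₁` (first row of the body, the second row of `μ`) and `t` the number of rows of `ν`.
The hook length formula with the first row peeled off (`numStandardTableaux_mul_prod_firstRow`:
`f^μ · ∏_{s<a} ((a - s) + ν'_s) · m! = n! · f^ν`), together with `ν'_s ≤ t` and `ν'_s = 0` for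
`s ≥ b`, gives the two division-free bounds
* (A) `C(n, m) ≤ f^μ · C(a + t, t)` (`dimGrowth_choose_le_mul_choose`);
* (B) `C(n, m) · ∏_{s<b} (a - s) ≤ f^μ · ∏_{s<b} (a - s + t)` (`dimGrowth_choose_mul_prod_le`).
Also: the bookkeeping `b ≤ a`, `b + t ≤ m + 1`, `card μ.parts = t + 1`, `n ≤ μ₁ · card μ.parts`,
the transposition facts `f^{μᵀ} = f^μ` (through `S^μ ≃ S^{μᵀ}`, `spechtIdealTransposeEquiv`, and
`dim S^μ = f^μ`, `finrank_spechtIdeal_holds`), `(μᵀ)₁ = card μ.parts`, `card μᵀ.parts = μ₁`, and the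
binomial estimate `C(a+t, t) · ((a+t+d)/(t+d))^d ≤ C(a+t+d, t+d)` (`dimGrowth_choose_mul_pow_le`; in
particular `(n/m)^m ≤ C(n, m)`).
-/

set_option linter.dupNamespace false

open scoped BigOperators Matrix ComplexOrder
open Finset
open Literature.NumberTheory.DiophantineGeometry (numStandardTableaux spechtCharacter)

namespace Summit.MatrixMultiplication.MatrixMultiplication.Theorems.GlobalBranch

open Literature.NumberTheory.DiophantineGeometry

section DimGrowthPeel

variable {n m a : ℕ} {μ : Nat.Partition n} {ν : Nat.Partition m}

/-! ### First row, first column, transposition -/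

/-- The first column of the Young diagram of `μ` has `card μ.parts` boxes. [folklore] -/
theorem dimGrowth_colLen_youngDiagram_zero (μ : Nat.Partition n) :
    μ.youngDiagram.colLen 0 = Multiset.card μ.parts := by
  -- adapted from Theorems/SnSubsetDichotomyGlobalBranchStubPartitionNumerics.lean
  rw [← YoungDiagram.length_rowLens, μ.rowLens_youngDiagram, μ.length_sortedParts]

/-- The first row of the Young diagram of `μ` has `μ.parts.sup` boxes. [folklore] -/
theorem dimGrowth_rowLen_youngDiagram_zero (μ : Nat.Partition n) :
    μ.youngDiagram.rowLen 0 = μ.parts.sup := by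
  -- adapted from Theorems/SnSubsetDichotomyGlobalBranchStubPartitionNumerics.lean
  rcases Nat.eq_zero_or_pos n with rfl | hn
  · have h1 := rowLen_youngDiagram_zero_le μ
    have h2 : μ.parts.sup ≤ 0 :=
      Multiset.sup_le.2 fun b hb => (Multiset.le_sum_of_mem hb).trans_eq μ.parts_sum
    omega
  · obtain ⟨ν, hs⟩ := exists_sortedParts_eq_sup_cons μ hn.ne'
    rw [youngDiagram_eq_ofRowLens_cons hs (sortedGE_cons_of_sortedParts_eq hs)]
    exact rowLen_ofRowLens_cons_zero _

/-- `card μᵀ.parts = μ₁` (conjugate partition). [folklore] -/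
theorem dimGrowth_card_parts_transpose (μ : Nat.Partition n) :
    Multiset.card μ.transpose.parts = μ.parts.sup := by
  rw [← dimGrowth_colLen_youngDiagram_zero, μ.youngDiagram_transpose,
    YoungDiagram.colLen_transpose, dimGrowth_rowLen_youngDiagram_zero]

/-- `(μᵀ)₁ = card μ.parts` (conjugate partition). [folklore] -/
theorem dimGrowth_sup_parts_transpose (μ : Nat.Partition n) :
    μ.transpose.parts.sup = Multiset.card μ.parts := by
  rw [← dimGrowth_rowLen_youngDiagram_zero, μ.youngDiagram_transpose,
    YoungDiagram.rowLen_transpose, dimGrowth_colLen_youngDiagram_zero]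

/-- `f^{μᵀ} = f^μ` (`S^μ ≃ S^{μᵀ}` linearly, and `dim S^μ = f^μ`). [folklore] -/
theorem dimGrowth_numStandardTableaux_transpose (μ : Nat.Partition n) :
    numStandardTableaux μ.transpose = numStandardTableaux μ := by
  -- adapted from Theorems/SnSubsetDichotomyGlobalBranchStubPartitionNumerics.lean
  rw [← finrank_spechtIdeal_holds ℚ μ, ← finrank_spechtIdeal_holds ℚ μ.transpose]
  exact (spechtIdealTransposeEquiv ℚ μ).finrank_eq.symm

/-- A partition of `n` with largest part `μ₁` and `μ₁'` parts has `n ≤ μ₁ · μ₁'`. [folklore] -/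
theorem dimGrowth_le_sup_mul_card (μ : Nat.Partition n) :
    n ≤ μ.parts.sup * Multiset.card μ.parts := by
  have h := Multiset.sum_le_card_nsmul μ.parts μ.parts.sup fun x hx => Multiset.le_sup hx
  rw [μ.parts_sum, smul_eq_mul] at h
  rwa [mul_comm]

/-! ### Combinatorics of the body `ν` of `μ = (a, ν)` -/

/-- If `μ = (a, ν)` then the first row of the body is at most `a` (`μ₂ ≤ μ₁`). [folklore] -/
theorem dimGrowth_rowLen_body_le (hs : μ.sortedParts = a :: ν.sortedParts) :
    ν.youngDiagram.rowLen 0 ≤ a := by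
  have H := sortedGE_cons_of_sortedParts_eq hs
  have h2 := (YoungDiagram.ofRowLens (a :: ν.sortedParts) H).rowLen_anti 0 (0 + 1) (Nat.zero_le _)
  rwa [rowLen_ofRowLens_cons_succ H ν.sortedGE_sortedParts 0, rowLen_ofRowLens_cons_zero H] at h2

/-- For `ν ⊢ m`: (first row) + (first column) `≤ m + 1` (they share only the box `(0,0)`).
[folklore] -/
theorem dimGrowth_rowLen_add_colLen_le (ν : Nat.Partition m) :
    ν.youngDiagram.rowLen 0 + ν.youngDiagram.colLen 0 ≤ m + 1 := by
  classical
  rw [ν.youngDiagram.rowLen_eq_card, ν.youngDiagram.colLen_eq_card,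
    ← Finset.card_union_add_card_inter]
  refine Nat.add_le_add ?_ (Finset.card_le_one.2 fun c hc d hd => ?_)
  · calc (ν.youngDiagram.row 0 ∪ ν.youngDiagram.col 0).card ≤ ν.youngDiagram.cells.card :=
          Finset.card_le_card (Finset.union_subset
            (fun c hc => (YoungDiagram.mem_cells _).2 (YoungDiagram.mem_row_iff.1 hc).1)
            (fun c hc => (YoungDiagram.mem_cells _).2 (YoungDiagram.mem_col_iff.1 hc).1))
      _ = m := ν.card_cells_youngDiagram
  · rw [Finset.mem_inter, YoungDiagram.mem_row_iff, YoungDiagram.mem_col_iff] at hc hd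
    exact Prod.ext (hc.1.2.trans hd.1.2.symm) (hc.2.2.trans hd.2.2.symm)

/-- For `ν ⊢ m` with `m ≠ 0` the first row is nonempty. [folklore] -/
theorem dimGrowth_rowLen_pos (ν : Nat.Partition m) (hm : m ≠ 0) :
    0 < ν.youngDiagram.rowLen 0 := by
  have h : 0 < ν.youngDiagram.colLen 0 := by
    rw [dimGrowth_colLen_youngDiagram_zero]
    refine Nat.pos_of_ne_zero fun h0 => hm ?_
    rw [← ν.parts_sum, Multiset.card_eq_zero.1 h0, Multiset.sum_zero]
  exact YoungDiagram.mem_iff_lt_rowLen.1 (YoungDiagram.mem_iff_lt_colLen.2 h)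

/-- The columns `s ≥ ν₁` of the body are empty. [folklore] -/
theorem dimGrowth_colLen_eq_zero_of_rowLen_le (ν : Nat.Partition m) {s : ℕ}
    (hs : ν.youngDiagram.rowLen 0 ≤ s) : ν.youngDiagram.colLen s = 0 := by
  by_contra h0
  have h1 : (0, s) ∈ ν.youngDiagram := YoungDiagram.mem_iff_lt_colLen.2 (Nat.pos_of_ne_zero h0)
  have h2 := YoungDiagram.mem_iff_lt_rowLen.1 h1
  omega

/-- If `μ = (a, ν)` then `card μ.parts = (number of rows of ν) + 1`. [folklore] -/
theorem dimGrowth_card_parts_eq (hs : μ.sortedParts = a :: ν.sortedParts) :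
    Multiset.card μ.parts = ν.youngDiagram.colLen 0 + 1 := by
  rw [dimGrowth_colLen_youngDiagram_zero, ← μ.length_sortedParts, hs, List.length_cons,
    ν.length_sortedParts]

/-! ### The two peeling bounds (division-free, in `ℕ`) -/

/-- `∏_{s<a} (a - s + t) · t! = (a + t)!`. [folklore] -/
theorem dimGrowth_prod_range_sub_add_mul_factorial (a t : ℕ) :
    (∏ s ∈ Finset.range a, (a - s + t)) * t.factorial = (a + t).factorial := by
  induction a with
  | zero => simp
  | succ r ih =>
    rw [Finset.prod_range_succ']
    have h1 : ∀ i ∈ Finset.range r, r + 1 - (i + 1) + t = r - i + t := fun i _ => by omega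
    rw [Finset.prod_congr rfl h1, Nat.sub_zero, mul_right_comm, ih,
      show r + 1 + t = (r + t) + 1 by omega, Nat.factorial_succ, mul_comm]

/-- **Bound (A)**: `C(n, m) ≤ f^{(a,ν)} · C(a + t, t)` with `t` the number of rows of `ν ⊢ m`
(the first-row hooks satisfy `(a - s) + ν'_s ≤ (a - s) + t`, so their product is `≤ (a+t)!/t!`).
[folklore] -/
theorem dimGrowth_choose_le_mul_choose (hs : μ.sortedParts = a :: ν.sortedParts) :
    n.choose m ≤ numStandardTableaux μ *
      (a + ν.youngDiagram.colLen 0).choose (ν.youngDiagram.colLen 0) := by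
  set t := ν.youngDiagram.colLen 0 with ht
  have hnm : a + m = n := add_eq_of_sortedParts_eq_cons hs
  have key := numStandardTableaux_mul_prod_firstRow hs
  have hP : ∏ s ∈ Finset.range a, ((a - s) + ν.youngDiagram.colLen s) ≤
      ∏ s ∈ Finset.range a, (a - s + t) :=
    Finset.prod_le_prod' fun s _ =>
      Nat.add_le_add_left (ν.youngDiagram.colLen_anti 0 s (Nat.zero_le _)) _
  have hν : 0 < numStandardTableaux ν := numStandardTableaux_pos_holds ν
  have h1 : n.choose m * (a.factorial * t.factorial * m.factorial) ≤
      numStandardTableaux μ * (a + t).choose t * (a.factorial * t.factorial * m.factorial) :=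
    calc n.choose m * (a.factorial * t.factorial * m.factorial)
        = n.factorial * t.factorial := by
          rw [← hnm, ← Nat.add_choose_mul_factorial_mul_factorial a m]; ring
      _ ≤ n.factorial * numStandardTableaux ν * t.factorial :=
          Nat.mul_le_mul_right _ (Nat.le_mul_of_pos_right _ hν)
      _ = numStandardTableaux μ *
            ((∏ s ∈ Finset.range a, ((a - s) + ν.youngDiagram.colLen s)) * m.factorial) *
            t.factorial := by rw [key]
      _ ≤ numStandardTableaux μ * ((∏ s ∈ Finset.range a, (a - s + t)) * m.factorial) *
            t.factorial :=
          Nat.mul_le_mul_right _ (Nat.mul_le_mul_left _ (Nat.mul_le_mul_right _ hP))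
      _ = numStandardTableaux μ * m.factorial *
            ((∏ s ∈ Finset.range a, (a - s + t)) * t.factorial) := by ring
      _ = numStandardTableaux μ * (a + t).choose t *
            (a.factorial * t.factorial * m.factorial) := by
          rw [dimGrowth_prod_range_sub_add_mul_factorial,
            ← Nat.add_choose_mul_factorial_mul_factorial a t]; ring
  exact Nat.le_of_mul_le_mul_right h1 (by positivity)

/-- **Bound (B)**: `C(n, m) · ∏_{s<b} (a - s) ≤ f^{(a,ν)} · ∏_{s<b} (a - s + t)` with `b = ν₁` the
first row and `t` the number of rows of `ν ⊢ m` (first-row hooks: `(a - s) + ν'_s ≤ (a - s) + t`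
for `s < b` and `= a - s` for `s ≥ b`; and `a! = ∏_{s<b} (a - s) · ∏_{b ≤ s < a} (a - s)`).
[folklore] -/
theorem dimGrowth_choose_mul_prod_le (hs : μ.sortedParts = a :: ν.sortedParts) :
    n.choose m * ∏ s ∈ Finset.range (ν.youngDiagram.rowLen 0), (a - s) ≤
      numStandardTableaux μ *
        ∏ s ∈ Finset.range (ν.youngDiagram.rowLen 0), (a - s + ν.youngDiagram.colLen 0) := by
  set b := ν.youngDiagram.rowLen 0 with hb
  set t := ν.youngDiagram.colLen 0 with ht
  have hba : b ≤ a := dimGrowth_rowLen_body_le hs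
  have hnm : a + m = n := add_eq_of_sortedParts_eq_cons hs
  have key := numStandardTableaux_mul_prod_firstRow hs
  have hν : 0 < numStandardTableaux ν := numStandardTableaux_pos_holds ν
  set R := ∏ s ∈ Finset.Ico b a, (a - s) with hR
  have hR0 : 0 < R := Finset.prod_pos fun s hs => by rw [Finset.mem_Ico] at hs; omega
  have hP : ∏ s ∈ Finset.range a, ((a - s) + ν.youngDiagram.colLen s) ≤
      (∏ s ∈ Finset.range b, (a - s + t)) * R := by
    rw [← Finset.prod_range_mul_prod_Ico _ hba]
    refine Nat.mul_le_mul (Finset.prod_le_prod' fun s _ =>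
      Nat.add_le_add_left (ν.youngDiagram.colLen_anti 0 s (Nat.zero_le _)) _) (le_of_eq ?_)
    exact Finset.prod_congr rfl fun s hs => by
      rw [dimGrowth_colLen_eq_zero_of_rowLen_le ν (Finset.mem_Ico.1 hs).1, Nat.add_zero]
  have hfac : a.factorial = (∏ s ∈ Finset.range b, (a - s)) * R := by
    rw [← prod_range_self_sub_eq_factorial, ← Finset.prod_range_mul_prod_Ico _ hba]
  have h1 : n.choose m * (∏ s ∈ Finset.range b, (a - s)) * (R * m.factorial) ≤
      numStandardTableaux μ * (∏ s ∈ Finset.range b, (a - s + t)) * (R * m.factorial) :=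
    calc n.choose m * (∏ s ∈ Finset.range b, (a - s)) * (R * m.factorial)
        = n.factorial := by
          rw [← hnm, ← Nat.add_choose_mul_factorial_mul_factorial a m, hfac]; ring
      _ ≤ n.factorial * numStandardTableaux ν := Nat.le_mul_of_pos_right _ hν
      _ = numStandardTableaux μ *
            ((∏ s ∈ Finset.range a, ((a - s) + ν.youngDiagram.colLen s)) * m.factorial) :=
          key.symm
      _ ≤ numStandardTableaux μ * ((∏ s ∈ Finset.range b, (a - s + t)) * R * m.factorial) :=
          Nat.mul_le_mul_left _ (Nat.mul_le_mul_right _ hP)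
      _ = numStandardTableaux μ * (∏ s ∈ Finset.range b, (a - s + t)) * (R * m.factorial) := by
          ring
  exact Nat.le_of_mul_le_mul_right h1 (by positivity)

/-! ### Binomial estimates -/

/-- `C(a+t, t) · ((a+t+d)/(t+d))^d ≤ C(a+t+d, t+d)`: each of the `d` extra factors
`(a+t+i)/(t+i)`, `i = 1..d`, of `C(a+t+d, t+d)/C(a+t, t)` is `≥ (a+t+d)/(t+d)`. [folklore] -/
theorem dimGrowth_choose_mul_pow_le (a t d : ℕ) :
    ((a + t).choose t : ℝ) * (((a + t + d : ℕ) : ℝ) / ((t + d : ℕ) : ℝ)) ^ d ≤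
      ((a + t + d).choose (t + d) : ℝ) := by
  induction d with
  | zero => simp
  | succ d ih =>
    rw [show a + t + (d + 1) = a + t + d + 1 from (add_assoc _ _ _).symm,
      show t + (d + 1) = t + d + 1 from (add_assoc _ _ _).symm]
    set x : ℝ := ((a + t + d : ℕ) : ℝ) / ((t + d : ℕ) : ℝ) with hx
    set y : ℝ := ((a + t + d + 1 : ℕ) : ℝ) / ((t + d + 1 : ℕ) : ℝ) with hy
    have hq : (0 : ℝ) < ((t + d + 1 : ℕ) : ℝ) := by positivity
    have hy0 : 0 ≤ y := by positivity
    have hstep : (((a + t + d + 1).choose (t + d + 1) : ℕ) : ℝ) =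
        ((a + t + d).choose (t + d) : ℝ) * y := by
      rw [hy, ← mul_div_assoc, eq_div_iff hq.ne']
      have h := Nat.add_one_mul_choose_eq (a + t + d) (t + d)
      rw [mul_comm] at h
      exact_mod_cast h.symm
    have hxy : y ^ d ≤ x ^ d := by
      rcases Nat.eq_zero_or_pos d with rfl | hd
      · simp
      · refine pow_le_pow_left₀ hy0 ?_ d
        have hq' : (0 : ℝ) < ((t + d : ℕ) : ℝ) := by exact_mod_cast (show 0 < t + d by omega)
        rw [hy, hx, div_le_div_iff₀ hq hq']
        exact_mod_cast (show (a + t + d + 1) * (t + d) ≤ (a + t + d) * (t + d + 1) by nlinarith)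
    calc ((a + t).choose t : ℝ) * y ^ (d + 1) = ((a + t).choose t : ℝ) * y ^ d * y := by ring
      _ ≤ ((a + t).choose t : ℝ) * x ^ d * y :=
          mul_le_mul_of_nonneg_right (mul_le_mul_of_nonneg_left hxy (Nat.cast_nonneg _)) hy0
      _ ≤ ((a + t + d).choose (t + d) : ℝ) * y := mul_le_mul_of_nonneg_right ih hy0
      _ = (((a + t + d + 1).choose (t + d + 1) : ℕ) : ℝ) := hstep.symm

/-- `(n/m)^m ≤ C(n, m)` for `n = a + m`. [folklore] -/
theorem dimGrowth_pow_le_choose (a m : ℕ) :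
    (((a + m : ℕ) : ℝ) / m) ^ m ≤ ((a + m).choose m : ℝ) := by
  have h := dimGrowth_choose_mul_pow_le a 0 m
  simp only [add_zero, Nat.choose_zero_right, Nat.cast_one, one_mul, zero_add] at h
  exact h

/-- `C(a+t, t) · (n/m)^{m-t} ≤ C(n, m)` for `n = a + m`, `t ≤ m`. [folklore] -/
theorem dimGrowth_choose_mul_pow_le_choose {a t m : ℕ} (ht : t ≤ m) :
    ((a + t).choose t : ℝ) * (((a + m : ℕ) : ℝ) / m) ^ (m - t) ≤ ((a + m).choose m : ℝ) := by
  have h := dimGrowth_choose_mul_pow_le a t (m - t)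
  rwa [show a + t + (m - t) = a + m by omega, show t + (m - t) = m by omega] at h

/-- **Peeling bounds (A) and (B) together** (registered helper stub `stub_dimGrowthPeel` of the
stub `stub_dimGrowth`): for `μ = (a, ν) ⊢ n`, `ν ⊢ m`, with `b = ν₁` and `t` the number of rows of
`ν`, `C(n, m) ≤ f^μ · C(a + t, t)` and `C(n, m) · ∏_{s<b} (a - s) ≤ f^μ · ∏_{s<b} (a - s + t)`.
[folklore] -/
theorem stub_dimGrowthPeel {n m a : ℕ} (μ : Nat.Partition n) (ν : Nat.Partition m)
    (hs : μ.sortedParts = a :: ν.sortedParts) :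
    n.choose m ≤ numStandardTableaux μ *
        (a + ν.youngDiagram.colLen 0).choose (ν.youngDiagram.colLen 0) ∧
      n.choose m * ∏ s ∈ Finset.range (ν.youngDiagram.rowLen 0), (a - s) ≤
        numStandardTableaux μ *
          ∏ s ∈ Finset.range (ν.youngDiagram.rowLen 0), (a - s + ν.youngDiagram.colLen 0) :=
  ⟨dimGrowth_choose_le_mul_choose hs, dimGrowth_choose_mul_prod_le hs⟩

end DimGrowthPeel

end Summit.MatrixMultiplication.MatrixMultiplication.Theorems.GlobalBranch
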